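import Summits.PneNP.PneNP.Theorems.ConvexRankGatesCliqueExtLowerBoundWidthThresholdDefs
import Literature.Computability.Complexity.ExtMonotoneGates
import Literature.Computability.Complexity.MonotoneSwitching
import Mathlib

/-!
# "All of `P` on" is ONE PERM gate reading ONE CNF of unit clauses
(stub `exists_permGate_unitCnf` of the line `width-threshold-certificate-sparsity`, §1g `LocalityMustGrow`,
crux `ConvexRankGates.CliqueExtLowerBound`, stmt-PneNP-10682; lead c13)

For a set `P` of edge slots of `K_m`, the monotone pattern function `x ↦ [∀ e ∈ P, x e = 1]` is realised,
in the r8 currency of the line (a PERM gate `φ` composed with monotone CNFs `C j` of the edge slots, the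
composed function being `x ↦ φ.2 (fun j => decide (EvalCNF (C j) x))`), by

* the identity gate `φ = ⟨1, v ↦ v 0⟩`, which is a PERM gate on `2 ≤ d` points: one generator
  `σ 0 = swap 0 1 ∈ Sym (Fin 2)` and the target `τ = swap 0 1` (if the wire is on, `τ` is a generator;
  if it is off, the generating set is empty, its closure is trivial, and `swap 0 1 ≠ 1`);
* the single child `C 0 = P.image ({·})`, the CNF of the unit clauses `{e}`, `e ∈ P` (clauses of size
  `1 ≤ s - 1` for `s ≥ 2`), whose value at `x` is `∀ e ∈ P, x e = 1`.
-/

set_option linter.dupNamespace false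

open Literature.Computability.Complexity Filter Finset
open Summit.PneNP.PneNP.Theorems.CliqueExtLowerBound.WidthThreshold

noncomputable section

namespace Summit.PneNP.PneNP.Theorems.CliqueExtLowerBound.WidthThreshold.UnitCnfPermGate

/-- The identity gate `⟨1, v ↦ v 0⟩` is a PERM gate on `d` points for every `d ≥ 2`: in `Sym (Fin 2)` take the
single generator `σ 0 = swap 0 1` and the target `τ = swap 0 1`; if the wire is on, `τ` is a generator
(`Subgroup.subset_closure`); if it is off, the generating set is empty, the closure is `⊥`, and `swap 0 1 ≠ 1`.
[folklore] -/
theorem isPermGate_id {d : ℕ} (hd : 2 ≤ d) : IsPermGate d ⟨1, fun v => v 0⟩ := by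
  refine ⟨2, hd, fun _ => Equiv.swap 0 1, Equiv.swap 0 1, fun v => ?_⟩
  dsimp only
  cases h : v 0
  · simp only [Bool.false_eq_true, false_iff]
    have hempty : {i : Fin 1 | v i = true} = ∅ := by
      ext i
      simp [Fin.fin_one_eq_zero i, h]
    rw [hempty, Set.image_empty, Subgroup.closure_empty, Subgroup.mem_bot, Equiv.swap_eq_one_iff]
    exact Fin.zero_ne_one
  · simp only [true_iff]
    exact Subgroup.subset_closure ⟨0, h, rfl⟩

/-- The CNF of the unit clauses `{e}`, `e ∈ P`, computes `∀ e ∈ P, x e = 1`. [folklore] -/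
theorem evalCNF_image_singleton {m : ℕ} (P : Finset (EV m)) (x : EV m → Bool) :
    EvalCNF (P.image fun e => ({e} : Finset (EV m))) x ↔ ∀ e ∈ P, x e = true := by
  refine ⟨fun h e he => ?_, fun h S hS => ?_⟩
  · obtain ⟨i, hi, hx⟩ := h {e} (Finset.mem_image_of_mem _ he)
    rw [Finset.mem_singleton] at hi
    exact hi ▸ hx
  · obtain ⟨e, he, rfl⟩ := Finset.mem_image.1 hS
    exact ⟨e, Finset.mem_singleton_self e, h e he⟩

open Classical in
/-- REGISTERED SUB-GOAL `exists_permGate_unitCnf` of the line `width-threshold-certificate-sparsity` (§1g, lead c13):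
the pattern function "all of `P` on" is ONE PERM gate on `d ≥ 2` points reading ONE CNF of unit clauses — the
identity gate `⟨1, v ↦ v 0⟩` (`σ 0 = τ = swap 0 1` in `Sym (Fin 2)`, `isPermGate_id`) with the single child
`P.image ({·})` (clauses of size `1 ≤ s - 1`, value `∀ e ∈ P, x e = 1` by `evalCNF_image_singleton`). [folklore] -/
theorem exists_permGate_unitCnf : ∀ (m d s : ℕ), 2 ≤ d → 2 ≤ s → ∀ P : Finset (EV m),
    ∃ (φ : GateFn) (C : Fin φ.1 → Finset (Finset (EV m))), IsPermGate d φ ∧ #(univ.image C) ≤ 1 ∧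
      (∀ j, ∀ S ∈ C j, #S ≤ s - 1) ∧
      ∀ x : EV m → Bool, φ.2 (fun j => decide (EvalCNF (C j) x)) = decide (∀ e ∈ P, x e = true) := by
  intro m d s hd hs P
  refine ⟨⟨1, fun v => v 0⟩, fun _ => P.image fun e => ({e} : Finset (EV m)), isPermGate_id hd, ?_, ?_, ?_⟩
  · exact Finset.card_image_le.trans (by simp)
  · intro j S hS
    obtain ⟨e, -, rfl⟩ := Finset.mem_image.1 hS
    rw [Finset.card_singleton]
    omega
  · intro x
    dsimp only
    rw [Bool.eq_iff_iff]
    simp only [decide_eq_true_eq]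
    exact evalCNF_image_singleton P x

end Summit.PneNP.PneNP.Theorems.CliqueExtLowerBound.WidthThreshold.UnitCnfPermGate

end
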